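import Mathlib
import Literature.Computability.Cryptography.ModExpCircuits

/-!
# `FeketeSOS.SOSMagnification` (stmt-ValiantsHypothesis-3995), line sml-polarised-transport —
# Stub C1 `stub_legendreCircuit`

The arithmetic core of the coefficient circuit of the one-hot base-`k` digit lift of the Fekete
polynomial: a fan-in-two Boolean straight-line program which, reading the one-hot wires
`x_{(j,i)} = [d_j = i]` of a digit vector `d : Fin n → Fin k`, decides by EULER'S CRITERION
whether `m(d) ^ (p / 2) = 1` (output `b = false`) resp. `= -1` (output `b = true`) in `ZMod p`,
where `m(d) = Σ_j d_j k^j` and the prime `p ≤ 2^ℓ` is hard-wired; its size is polynomial in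
`n, k, ℓ`
(we give `120 · N^120`, `N = (n+1)(k+1)(ℓ+1)`, a crude closed form of the actual `O(N⁴)`).

Construction, entirely inside the tree's bus calculus `CktSizeVia` / `HasBits`
(`AlgebraicComplexity/BurgisserBooleanPartsModPCircuits.lean`,
`Cryptography/ModExpCircuits.lean`):
(1) each bit of the residue `d_j k^j mod p` is the masked parity of block `j` of the bus against
the hard-wired bit pattern of the `k` candidate constants `i k^j mod p`
(`CktSizeVia.maskedParity`);
(2) the residues are summed by the school modular adder (`HasBits.add`);
(3) the sum is raised to the hard-wired exponent `p / 2` by square-and-multiply (`HasBits.pow`);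
(4) the `ℓ` result bits are compared with the bit patterns of `1` and of `-1`
(`CktSizeVia.allMatch`).
[folklore]
-/

noncomputable section

namespace Summit.ValiantsHypothesis.ValiantsHypothesis.Theorems.FeketeSOSSOSMagnification

open Literature.Computability.AlgebraicComplexity
open Literature.Computability.Complexity (CktSize B2)
open Literature.Computability.Cryptography (powCost powStepCost)

-- `Summit.ValiantsHypothesis.ValiantsHypothesis.…` is the tree's mandated single-conjunct layout
-- (Sub = Summit).
set_option linter.dupNamespace false

/-- Finite sums of residues available in binary from a bus are available, one modular adder per
summand: cost `ℓ + #s · (c + modAddCost ℓ)`. [folklore] -/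
theorem legC_hasBits_finsetSum {p : ℕ} [NeZero p] {ℓ : ℕ} {θ α ι : Type*}
    {e : θ → α → Bool} (hℓ : p ≤ 2 ^ ℓ) (v : ι → θ → ZMod p) {c : ℕ}
    (hv : ∀ i, HasBits ℓ e (v i) c) (s : Finset ι) :
    HasBits ℓ e (fun t => ∑ i ∈ s, v i t) (ℓ * 1 + s.card * (c + modAddCost ℓ)) := by
  classical
  induction s using Finset.induction_on with
  | empty =>
    refine ((HasBits.const ℓ e (0 : ZMod p)).congr fun t => ?_).of_le
      (Nat.le_add_right _ _)
    simp
  | insert a s ha ih =>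
    refine (((hv a).add hℓ ih).congr fun t => ?_).of_le (le_of_eq ?_)
    · simp only [Finset.sum_insert ha]
    · rw [Finset.card_insert_of_notMem ha]
      ring

/-- For a modulus `p ≤ 2^ℓ`, residues are determined by the `ℓ` low bits of their
representatives. [folklore] -/
theorem legC_testBits_val_inj {p : ℕ} [NeZero p] {ℓ : ℕ} (hℓ : p ≤ 2 ^ ℓ)
    (x y : ZMod p) :
    testBits ℓ x.val = testBits ℓ y.val ↔ x = y := by
  refine ⟨fun h => ZMod.val_injective p (Nat.eq_of_testBit_eq fun i => ?_),
    fun h => by rw [h]⟩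
  by_cases hi : i < ℓ
  · exact congrFun h ⟨i, hi⟩
  · have h2 : 2 ^ ℓ ≤ 2 ^ i := Nat.pow_le_pow_right Nat.two_pos (not_lt.1 hi)
    rw [Nat.testBit_lt_two_pow ((x.val_lt.trans_le hℓ).trans_le h2),
      Nat.testBit_lt_two_pow ((y.val_lt.trans_le hℓ).trans_le h2)]

/-- **Block reading.** From the one-hot bus `x_{(j,i)} = [d_j = i]`, the `ℓ` bits of the residue
`d_j k^j mod p` cost `ℓ (k + 1)` gates: bit `i` is the parity of the wires of block `j` masked by
the hard-wired bits `i` of the `k` constants `i' k^j mod p`. [folklore] -/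
theorem legC_hasBits_block {p : ℕ} [NeZero p] (k n ℓ : ℕ) (j : Fin n) :
    HasBits ℓ (fun (d : Fin n → Fin k) (v : Fin n × Fin k) => decide (d v.1 = v.2))
      (fun d => (((d j : ℕ) * k ^ (j : ℕ) : ℕ) : ZMod p)) (ℓ * (k + 1)) := by
  set enc : (Fin n → Fin k) → (Fin n × Fin k) → Bool := fun d v => decide (d v.1 = v.2)
    with henc
  have hbit : ∀ i : Fin ℓ, CktSizeVia enc
      (fun d (_ : Unit) => testBits ℓ ((((d j : ℕ) * k ^ (j : ℕ) : ℕ) : ZMod p)).val i)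
      (k + 1) := by
    intro i
    have h := (CktSizeVia.proj enc (fun i' : Fin k => (j, i'))).trans
      (Literature.Computability.Cryptography.CktSizeVia.maskedParity
        (fun d (i' : Fin k) => enc d (j, i'))
        (fun i' : Fin k => (((i' : ℕ) * k ^ (j : ℕ)) % p).testBit i) (List.finRange k))
    rw [List.length_finRange, Nat.zero_add] at h
    refine h.congr fun d => ?_
    funext u
    rw [Literature.Computability.Cryptography.maskedParity_finRange_eq_bodd,
      Finset.sum_eq_single (d j)]
    · rw [testBits_apply, ZMod.val_natCast]
      simp [henc, Literature.Computability.Cryptography.bodd_toNat']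
    · intro i' _ hne
      simp [henc, Ne.symm hne]
    · intro h
      exact absurd (Finset.mem_univ _) h
  have h := CktSizeVia.pi_const (κ := Fin ℓ) (e := enc) (s := k + 1)
    (f := fun d => testBits ℓ ((((d j : ℕ) * k ^ (j : ℕ) : ℕ) : ZMod p)).val) hbit
  rw [Fintype.card_fin] at h
  exact h

/-- **The digit value in binary.** From the one-hot bus, the `ℓ` bits of
`m(d) mod p = (Σ_j d_j k^j) mod p` cost `ℓ + n (ℓ (k+1) + modAddCost ℓ)` gates (block reading
and `n` modular additions). [folklore] -/
theorem legC_hasBits_digitSum {p : ℕ} [NeZero p] (k n ℓ : ℕ) (hℓ : p ≤ 2 ^ ℓ) :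
    HasBits ℓ (fun (d : Fin n → Fin k) (v : Fin n × Fin k) => decide (d v.1 = v.2))
      (fun d => ((∑ j : Fin n, (d j : ℕ) * k ^ (j : ℕ) : ℕ) : ZMod p))
      (ℓ * 1 + n * (ℓ * (k + 1) + modAddCost ℓ)) := by
  have h := legC_hasBits_finsetSum hℓ
    (fun (j : Fin n) (d : Fin n → Fin k) => (((d j : ℕ) * k ^ (j : ℕ) : ℕ) : ZMod p))
    (fun j => legC_hasBits_block k n ℓ j) Finset.univ
  rw [Finset.card_univ, Fintype.card_fin] at h
  refine h.congr fun d => ?_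
  simp only [Nat.cast_sum, Nat.cast_mul, Nat.cast_pow]

/-- **Euler's-criterion tests.** From the one-hot bus, the two bits
`[m(d)^(p/2) = 1]`, `[m(d)^(p/2) = -1]` (in `ZMod p`, `p ≤ 2^ℓ` hard-wired) cost
`2 · (ℓ + n (ℓ (k+1) + modAddCost ℓ) + powCost ℓ ℓ + ℓ + 1)` gates. [folklore] -/
theorem legC_cktSizeVia_tests {p : ℕ} [NeZero p] (k n ℓ : ℕ) (hℓ : p ≤ 2 ^ ℓ) :
    CktSizeVia (fun (d : Fin n → Fin k) (v : Fin n × Fin k) => decide (d v.1 = v.2))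
      (fun d (b : Bool) =>
        decide ((((∑ j : Fin n, (d j : ℕ) * k ^ (j : ℕ) : ℕ) : ZMod p) ^ (p / 2)) =
          if b then (-1 : ZMod p) else 1))
      (Fintype.card Bool *
        (ℓ * 1 + n * (ℓ * (k + 1) + modAddCost ℓ) + powCost ℓ ℓ + (ℓ + 1))) := by
  have hp : 0 < p := Nat.pos_of_ne_zero (NeZero.ne p)
  have hpow := Literature.Computability.Cryptography.HasBits.pow hℓ
    (legC_hasBits_digitSum k n ℓ hℓ) (k := p / 2) (w := ℓ)
    ((Nat.div_lt_self hp one_lt_two).trans_le hℓ)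
  refine CktSizeVia.pi_const (κ := Bool) fun b => ?_
  have h := CktSizeVia.trans hpow (Literature.Computability.Cryptography.CktSizeVia.allMatch
    (fun (d : Fin n → Fin k) =>
      testBits ℓ ((((∑ j : Fin n, (d j : ℕ) * k ^ (j : ℕ) : ℕ) : ZMod p) ^ (p / 2))).val)
    (testBits ℓ (if b then (-1 : ZMod p) else 1).val) (List.finRange ℓ))
  rw [List.length_finRange] at h
  refine h.congr fun d => ?_
  funext u
  rw [Literature.Computability.Cryptography.allMatch_finRange_eq_decide]
  exact decide_eq_decide.mpr (legC_testBits_val_inj hℓ _ _)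

/-- `powCost ℓ ℓ ≤ 46 (ℓ + 2)⁴`. [folklore] -/
theorem legC_powCost_le (ℓ : ℕ) : powCost ℓ ℓ ≤ 46 * (ℓ + 2) ^ 4 := by
  simp only [powCost, powStepCost, modMulCost, modMulStepCost, modAddCost]
  nlinarith [Nat.zero_le ℓ, Nat.zero_le (ℓ ^ 2), Nat.zero_le (ℓ ^ 3), Nat.zero_le (ℓ ^ 4)]

/-- The closed-form size bound: the gate count of the tests is at most `120 · N ^ 120`,
`N = (n+1)(k+1)(ℓ+1)` (in fact `≤ 116 N⁴`). [folklore] -/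
theorem legC_size_le (k n ℓ : ℕ) (hk : 2 ≤ k) :
    Fintype.card Bool *
        (ℓ * 1 + n * (ℓ * (k + 1) + modAddCost ℓ) + powCost ℓ ℓ + (ℓ + 1)) ≤
      120 * ((n + 1) * (k + 1) * (ℓ + 1)) ^ 120 := by
  generalize hN : (n + 1) * (k + 1) * (ℓ + 1) = N
  have hkl : 3 * (ℓ + 1) ≤ (k + 1) * (ℓ + 1) := Nat.mul_le_mul_right _ (by omega)
  have hN' : (k + 1) * (ℓ + 1) ≤ N := by
    rw [← hN, mul_assoc]
    exact Nat.le_mul_of_pos_left _ (Nat.succ_pos n)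
  have hN1 : 1 ≤ N := by omega
  have hXN : ℓ + 2 ≤ N := by omega
  have hnN : n ≤ N := by
    rw [← hN, mul_assoc]
    calc n ≤ n + 1 := Nat.le_succ n
      _ ≤ (n + 1) * ((k + 1) * (ℓ + 1)) := Nat.le_mul_of_pos_right _ (by positivity)
  have hbN : ℓ * (k + 1) ≤ N := by
    calc ℓ * (k + 1) ≤ (ℓ + 1) * (k + 1) := Nat.mul_le_mul_right _ (Nat.le_succ ℓ)
      _ = (k + 1) * (ℓ + 1) := mul_comm _ _
      _ ≤ N := hN'
  have hadd : modAddCost ℓ ≤ 9 * N ^ 2 := by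
    simp only [modAddCost]
    exact Nat.mul_le_mul_left 9 (Nat.pow_le_pow_left hXN 2)
  have hpw : powCost ℓ ℓ ≤ 46 * N ^ 4 :=
    (legC_powCost_le ℓ).trans (Nat.mul_le_mul_left 46 (Nat.pow_le_pow_left hXN 4))
  have hmid : n * (ℓ * (k + 1) + modAddCost ℓ) ≤ N ^ 2 + 9 * N ^ 3 :=
    calc n * (ℓ * (k + 1) + modAddCost ℓ) ≤ N * (N + 9 * N ^ 2) :=
          Nat.mul_le_mul hnN (Nat.add_le_add hbN hadd)
      _ = N ^ 2 + 9 * N ^ 3 := by ring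
  have h1 : N ≤ N ^ 4 := Nat.le_self_pow (by norm_num) N
  have h2 : N ^ 2 ≤ N ^ 4 := Nat.pow_le_pow_right hN1 (by norm_num)
  have h3 : N ^ 3 ≤ N ^ 4 := Nat.pow_le_pow_right hN1 (by norm_num)
  have h4 : N ^ 4 ≤ N ^ 120 := Nat.pow_le_pow_right hN1 (by norm_num)
  rw [Fintype.card_bool]
  clear hk hkl hN' hnN hbN hadd hN
  omega

/-- **Stub C1 (`stub_legendreCircuit`).** There is an absolute constant `c` (we take `c = 120`)
such that for all `k ≥ 2`, `n ≥ 1`, every bit length `ℓ` and every prime `p ≤ 2^ℓ` some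
`B₂`-straight-line program of size `≤ c · ((n+1)(k+1)(ℓ+1))^c` with two outputs
`b = false / true`, fed the one-hot encoding `x_{(j,i)} = [d_j = i]` of any digit vector
`d : Fin n → Fin k`, outputs `[m(d)^(p/2) = 1]` resp. `[m(d)^(p/2) = -1]` in `ZMod p`,
`m(d) = Σ_j d_j k^j` (Euler's criterion for the Legendre symbol of `m(d)`; on inputs that are not
one-hot the program is unconstrained). [folklore] -/
theorem stub_legendreCircuit :
    ∃ c : ℕ, ∀ (k n ℓ p : ℕ) [Fact p.Prime], 2 ≤ k → 1 ≤ n → p ≤ 2 ^ ℓ →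
      ∃ F : ((Fin n × Fin k) → Bool) → Bool → Bool,
        CktSize B2 F (c * ((n + 1) * (k + 1) * (ℓ + 1)) ^ c) ∧
        ∀ (d : Fin n → Fin k) (b : Bool),
          F (fun v => decide (d v.1 = v.2)) b =
            decide ((((∑ j : Fin n, (d j : ℕ) * k ^ (j : ℕ) : ℕ) : ZMod p) ^ (p / 2)) =
              if b then (-1 : ZMod p) else 1) := by
  refine ⟨120, ?_⟩
  intro k n ℓ p _ hk _ hℓ
  haveI : NeZero p := ⟨(Fact.out : p.Prime).ne_zero⟩
  obtain ⟨F, hF, hspec⟩ := legC_cktSizeVia_tests (p := p) k n ℓ hℓ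
  exact ⟨F, hF.of_le (legC_size_le k n ℓ hk), fun d b => congrFun (hspec d) b⟩

end Summit.ValiantsHypothesis.ValiantsHypothesis.Theorems.FeketeSOSSOSMagnification

end
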